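import Summits.AtomisticToContinuum.HydrodynamicLimit.Theorems.ImplosionDichotomyHsEosLowDensity
import Literature.MathematicalPhysics.KineticTheory.HardSphereEulerContinuationHolds
import Literature.MathematicalPhysics.KineticTheory.HardSphereEulerClassicalUniqueness
import Literature.MathematicalPhysics.KineticTheory.HardSphereEulerSolutionGluing
import HarnessLib

/-!
# RelayRaceLocality · ConeLocalisation — bubble stub, helper (E): existence on a prescribed horizon from a-priori bounds

Helper file for the lead-held stub `stub_bubble : BubbleAtScale` of the line `Sketch` (zoomed-bubble-transplant) of
the crux item `stmt-AtomisticToContinuum-12504` (`ConeLocalisation`, route RelayRaceLocality of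
`AtomisticToContinuum/HydrodynamicLimit`), lead prover-line-stmt-AtomisticToContinuum-12504-0 (2026-08-17).

The EXISTENCE half of the bubble lemma, separated from its analytic half (the a-priori estimate): if every classical
hard-sphere Euler solution from the given smooth data on any horizon `T ≤ T'` is known to obey state bounds
`Mb⁻¹ ≤ ρ, θ ≤ Mb`, `‖u‖ ≤ Mb`, first-derivative bounds `≤ Mb` and a packing bound `ρσ³ ≤ ηE` (with `ηE` the
common threshold of the tree's local existence, continuation and small-packing uniqueness theorems), then a classical
solution from these data exists on the whole horizon `[0, T')`. Proof: the soft continuation argument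
`IsHardSphereEulerSolution.exists_of_apriori` with property `P` := these bounds; its four inputs are the tree's
`hsEuler_localExistence_holds`, `hsEuler_uniqueness_smallPacking` (both solutions obey the packing bound by the
hypothesis), `hsEuler_continuation_holds`, and the hypothesis itself; the equation-of-state input of the three
named facts is the tree theorem `hsEosLowDensity_proof`.
-/

noncomputable section

namespace Summit.AtomisticToContinuum.HydrodynamicLimit.Theorems.ConeLocalisation.Bubble

open Set
open Literature.MathematicalPhysics.KineticTheory Literature.Analysis.FluidPDE
  Literature.Analysis.FunctionSpaces
open Summit.AtomisticToContinuum.HydrodynamicLimit.Theorems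

/-- **Existence on a prescribed horizon from a-priori bounds (hard spheres, unconditional).** There is a packing
threshold `ηE > 0` such that for every reduced diameter `σ > 0`, horizon `T' > 0`, bound `Mb > 0` and smooth positive
data `(ρ₀, θ₀, u₀)` with `ρ₀σ³ ≤ ηE`: if every classical solution from these data on `[0, T)`, `T ≤ T'`, satisfies
`Mb⁻¹ ≤ ρ ≤ Mb`, `Mb⁻¹ ≤ θ ≤ Mb`, `‖u‖ ≤ Mb`, `ρσ³ ≤ ηE` and `‖∂ᵢu‖, |∂ᵢρ|, |∂ᵢθ| ≤ Mb` pointwise on `[0, T)`, then a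
classical solution from these data exists on `[0, T')` (Kato 1975 / Majda 1984 Thm 2.2 continuation argument,
assembled from the tree's local existence, small-packing uniqueness and continuation theorems).
[cite: Majda1984, Ch. 2 Thm 2.2] -/
theorem exists_of_apriori_bounds :
    ∃ ηE : ℝ, 0 < ηE ∧ ∀ σ : ℝ, 0 < σ → ∀ (T' Mb : ℝ), 0 < T' → 0 < Mb →
      ∀ (ρ₀ θ₀ : T3 → ℝ) (u₀ : T3 → V3), Torus.IsSmooth ρ₀ → Torus.IsSmooth θ₀ → Torus.IsSmooth u₀ →
      (∀ x, 0 < ρ₀ x) → (∀ x, 0 < θ₀ x) → (∀ x, ρ₀ x * σ ^ 3 ≤ ηE) →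
      (∀ T : ℝ, T ≤ T' → ∀ (ρ θ : ℝ → T3 → ℝ) (u : ℝ → T3 → V3), IsHardSphereEulerSolution σ T ρ u θ →
        ρ 0 = ρ₀ → u 0 = u₀ → θ 0 = θ₀ →
        ∀ t ∈ Ico 0 T, ∀ x, Mb⁻¹ ≤ ρ t x ∧ ρ t x ≤ Mb ∧ Mb⁻¹ ≤ θ t x ∧ θ t x ≤ Mb ∧ ‖u t x‖ ≤ Mb ∧
          ρ t x * σ ^ 3 ≤ ηE ∧
          ∀ i : Fin 3, ‖Torus.partialDeriv i (u t) x‖ ≤ Mb ∧ |Torus.partialDeriv i (ρ t) x| ≤ Mb ∧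
            |Torus.partialDeriv i (θ t) x| ≤ Mb) →
      ∃ (ρ θ : ℝ → T3 → ℝ) (u : ℝ → T3 → V3),
        IsHardSphereEulerSolution σ T' ρ u θ ∧ ρ 0 = ρ₀ ∧ u 0 = u₀ ∧ θ 0 = θ₀ := by
  obtain ⟨η₀, hη₀, F, hFa, hEq, -, -, -⟩ := hsEosLowDensity_proof
  obtain ⟨ηL, hηL, HL⟩ := hsEuler_localExistence_holds η₀ hη₀ F hFa hEq
  obtain ⟨ηC, hηC, HC⟩ := hsEuler_continuation_holds η₀ hη₀ F hFa hEq
  obtain ⟨ηU, hηU, HU⟩ := hsEuler_uniqueness_smallPacking η₀ hη₀ F hFa hEq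
  refine ⟨min ηL (min ηC ηU), lt_min hηL (lt_min hηC hηU), ?_⟩
  intro σ hσ T' Mb hT' hMb ρ₀ θ₀ u₀ hρ₀ hθ₀ hu₀ hρ₀pos hθ₀pos hpack hbd
  have hEL : min ηL (min ηC ηU) ≤ ηL := min_le_left _ _
  have hEC : min ηL (min ηC ηU) ≤ ηC := (min_le_right _ _).trans (min_le_left _ _)
  have hEU : min ηL (min ηC ηU) ≤ ηU := (min_le_right _ _).trans (min_le_right _ _)
  -- the bound property
  set P : ℝ → (ℝ → T3 → ℝ) → (ℝ → T3 → V3) → (ℝ → T3 → ℝ) → Prop := fun T ρ u θ =>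
    ∀ t ∈ Ico 0 T, ∀ x, Mb⁻¹ ≤ ρ t x ∧ ρ t x ≤ Mb ∧ Mb⁻¹ ≤ θ t x ∧ θ t x ≤ Mb ∧ ‖u t x‖ ≤ Mb ∧
      ρ t x * σ ^ 3 ≤ min ηL (min ηC ηU) ∧
      ∀ i : Fin 3, ‖Torus.partialDeriv i (u t) x‖ ≤ Mb ∧ |Torus.partialDeriv i (ρ t) x| ≤ Mb ∧
        |Torus.partialDeriv i (θ t) x| ≤ Mb with hP
  refine IsHardSphereEulerSolution.exists_of_apriori P hT' ?_ ?_ ?_ ?_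
  · -- (i) local existence
    exact HL σ hσ ρ₀ θ₀ u₀ hρ₀ hθ₀ hu₀ hρ₀pos hθ₀pos fun x => (hpack x).trans hEL
  · -- (ii) uniqueness: both solutions obey the packing bound (a-priori bounds), then small-packing uniqueness
    intro T hT ρ₁ θ₁ u₁ ρ₂ θ₂ u₂ h₁ h₂ hρ₁ hu₁ hθ₁ hρ₂ hu₂ hθ₂
    have hp₁ : ∀ t ∈ Ico 0 T, ∀ x, ρ₁ t x * σ ^ 3 ≤ ηU :=
      fun t ht x => ((hbd T hT ρ₁ θ₁ u₁ h₁ hρ₁ hu₁ hθ₁ t ht x).2.2.2.2.2.1).trans hEU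
    have hp₂ : ∀ t ∈ Ico 0 T, ∀ x, ρ₂ t x * σ ^ 3 ≤ ηU :=
      fun t ht x => ((hbd T hT ρ₂ θ₂ u₂ h₂ hρ₂ hu₂ hθ₂ t ht x).2.2.2.2.2.1).trans hEU
    exact HU σ hσ T ρ₁ θ₁ u₁ ρ₂ θ₂ u₂ h₁ h₂ hp₁ hp₂ (hρ₁.trans hρ₂.symm) (hu₁.trans hu₂.symm)
      (hθ₁.trans hθ₂.symm)
  · -- (iii) continuation from the a-priori bounds
    intro T hT hTT' ρ θ u hE hρ hu hθ hPT
    refine HC σ hσ T Mb hT hMb ρ θ u hE fun t ht x => ?_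
    obtain ⟨g1, g2, g3, g4, g5, g6, g7⟩ := hPT t ht x
    exact ⟨g1, g2, g3, g4, g5, g6.trans hEC, g7⟩
  · -- (iv) the a-priori bounds themselves
    intro T hT ρ θ u hE hρ hu hθ
    exact hbd T hT ρ θ u hE hρ hu hθ

end Summit.AtomisticToContinuum.HydrodynamicLimit.Theorems.ConeLocalisation.Bubble

end
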